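import Mathlib
import HarnessLib

/-!
# Crux `EllipticGluingPrimeBound`, line Sketch — stub `stub_invariantPairing` (lever (i))

Pure algebra behind the isotypic–Minkowski reduction of the crux
`Summit.ABC.ABC.Theses.IsogenyGlueCongruence.EllipticGluingPrimeBound` (item stmt-ABC-13919):
if a finite group `G` acts `ℤ`-linearly on an abelian group `L`, every `G`-invariant vector of
`L` is an integer multiple of a fixed vector `v`, and `w : L → ℤ` is a `G`-invariant surjective
`ℤ`-linear functional, then `w v ∣ |G|`.

Proof: pick `x` with `w x = 1` and average it over `G`, `y := ∑ g, ρ g x`. Reindexing the sum by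
left translation shows that `y` is `G`-invariant, so `y = k • v` and `w y = k * w v`; on the other
hand `w y = ∑ g, w (ρ g x) = ∑ g, w x = |G|`. Hence `|G| = k * w v`.

In the crux, `L = Hom_ℚ̄(E, B_E)` is the Mazur–Rubin–Silverberg twisting lattice of the
geometrically `E`-isotypic part `B_E ≅ E ⊗ L`; `ℚ`-homomorphisms `E → B_E` form `L^G = ℤv`,
`ℚ`-homomorphisms `B_E → E` are the `G`-invariant functionals `w`, and an `E`-multiplier is a
composite `w v`. So a prime dividing every `E`-multiplier divides `|G|`, which Minkowski's bound
on finite subgroups of `GL_r(ℤ)` (the neighbouring stub of the line) then bounds by `rank L + 1`.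
Mathlib only; no literature input.
-/

-- `Summit.<Summit>.<Problem>` is the mandated summit-side namespace (CONVENTIONS §2); for the
-- single-conjunct summit `ABC` the two coincide, so the duplicate `ABC.ABC` is deliberate.
set_option linter.dupNamespace false

namespace Summit.ABC.ABC.Theorems.IsotypicMinkowski

/-- The `G`-average `∑ g, ρ g x` of any vector `x` is `G`-invariant: applying `ρ h` reindexes the
sum by left translation `g ↦ h * g`. -/
theorem rho_sum_eq_sum {G : Type*} [Group G] [Fintype G] {L : Type*} [AddCommGroup L]
    (ρ : Representation ℤ G L) (x : L) (h : G) :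
    ρ h (∑ g : G, ρ g x) = ∑ g : G, ρ g x := by
  rw [map_sum]
  exact Fintype.sum_bijective (h * ·) (Group.mulLeft_bijective h) _ _ fun g ↦ by
    rw [map_mul, Module.End.mul_apply]

/-- **Invariant pairing** (lever (i) of the isotypic–Minkowski reduction): if a finite group `G`
acts `ℤ`-linearly on `L`, every `G`-invariant vector is an integer multiple of `v`, and
`w : L → ℤ` is a `G`-invariant surjective functional, then `w v` divides `|G|`.
Average a preimage `x` of `1` over `G`: the average is invariant, hence `k • v`, and `w` of it is
both `k * w v` and `∑ g, w x = |G|`. -/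
theorem stub_invariantPairing {G : Type*} [Group G] [Fintype G] {L : Type*} [AddCommGroup L]
    (ρ : Representation ℤ G L) (v : L) (hv : ∀ x : L, (∀ g : G, ρ g x = x) → ∃ k : ℤ, x = k • v)
    (w : L →ₗ[ℤ] ℤ) (hw : ∀ (g : G) (x : L), w (ρ g x) = w x) (hsurj : Function.Surjective w) :
    w v ∣ (Fintype.card G : ℤ) := by
  obtain ⟨x, hx⟩ := hsurj 1
  obtain ⟨k, hk⟩ := hv (∑ g : G, ρ g x) fun h ↦ rho_sum_eq_sum ρ x h
  have hcard : w (∑ g : G, ρ g x) = (Fintype.card G : ℤ) := by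
    rw [map_sum]
    simp only [hw, hx, Finset.sum_const, Finset.card_univ, Nat.smul_one_eq_cast]
  have hmul : w (∑ g : G, ρ g x) = k * w v := by
    rw [hk, map_zsmul, smul_eq_mul]
  exact ⟨k, by rw [← hcard, hmul, mul_comm]⟩

end Summit.ABC.ABC.Theorems.IsotypicMinkowski
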